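import Mathlib

/-!
# Border half-dimension designs: the final numerics

This file proves the numerical estimate `stub_numerics` used in the refutation of the
span-count step of the `BorderHalfDimensionDesigns` line: for `n ≥ 3` there are `δ > 0` and
`q₀ : ℕ` such that for all `q ≥ q₀` and all `d : ℕ` with `d ≤ q ^ δ`,

`(d + 1) ^ n * (q * n * d + 1) ^ (n * (n - 1) / 2) < q ^ (n ^ 2 / 2 - n / 4)`.

## Proof sketch

Put `N := n * (n - 1) / 2` (an exact division), `δ := 1 / (4 * (n + N))`,
`C := 2 ^ n * (2 * n) ^ N`, and choose `q₀ ≥ C ^ 2 + 2`.  With `x := q ^ δ ≥ 1` and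
`y := q ^ (1 / 4) > 1` we have `x ^ (n + N) = y`, `y ^ 4 = q`, `d + 1 ≤ 2 * x` and
`q * n * d + 1 ≤ 2 * n * q * x`, whence the left-hand side is at most
`C * q ^ N * x ^ (n + N) = C * y ^ (4 * N + 1)`.  The right-hand side equals
`y ^ (4 * N + n)` because `n ^ 2 / 2 - n / 4 = (4 * N + n) / 4`, and finally
`C < y ^ 2 ≤ y ^ (n - 1)` since `C ^ 2 < q = y ^ 4` and `n - 1 ≥ 2`.
-/

set_option linter.dupNamespace false

namespace Summit.MatrixMultiplication.MatrixMultiplication.Theorems.BorderHalfDimensionDesigns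

/-- The division in the triangular number `n * (n - 1) / 2` is exact. -/
private lemma triangle_div_two_mul_two (n : ℕ) : n * (n - 1) / 2 * 2 = n * (n - 1) :=
  Nat.div_mul_cancel (Nat.even_mul_pred_self n).two_dvd

/-- Real-number form of `triangle_div_two_mul_two`. -/
private lemma cast_triangle_mul_two (n : ℕ) (hn : 0 < n) :
    ((n * (n - 1) / 2 : ℕ) : ℝ) * 2 = (n : ℝ) * ((n : ℝ) - 1) := by
  rw [← Nat.cast_pred hn]
  exact_mod_cast triangle_div_two_mul_two n

/-- **Final numerics.** For `n ≥ 3` there are `δ > 0` and `q₀` such that for all `q ≥ q₀` and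
all `d ≤ q ^ δ` the span-count bound `(d + 1) ^ n * (q * n * d + 1) ^ (n * (n - 1) / 2)` is
strictly below `q ^ (n ^ 2 / 2 - n / 4)`. -/
theorem stub_numerics (n : ℕ) (hn : 3 ≤ n) :
    ∃ δ : ℝ, 0 < δ ∧ ∃ q₀ : ℕ, ∀ q : ℕ, q₀ ≤ q → ∀ d : ℕ, (d : ℝ) ≤ (q : ℝ) ^ δ →
      (((d + 1) ^ n * (q * n * d + 1) ^ (n * (n - 1) / 2) : ℕ) : ℝ) <
        (q : ℝ) ^ ((n : ℝ) ^ 2 / 2 - 1 / 4 * (n : ℝ)) := by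
  -- The triangular number `N` and the constant `C`.
  obtain ⟨N, hN⟩ : ∃ N : ℕ, N = n * (n - 1) / 2 := ⟨_, rfl⟩
  have hNreal : (N : ℝ) * 2 = (n : ℝ) * ((n : ℝ) - 1) := by
    rw [hN]
    exact cast_triangle_mul_two n (by omega)
  rw [← hN]
  obtain ⟨C, hC⟩ : ∃ C : ℝ, C = 2 ^ n * (2 * (n : ℝ)) ^ N := ⟨_, rfl⟩
  have hn0 : (0 : ℝ) < n := by exact_mod_cast (show 0 < n by omega)
  have hn1 : (1 : ℝ) ≤ n := by exact_mod_cast (show 1 ≤ n by omega)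
  have hN0 : (0 : ℝ) ≤ N := Nat.cast_nonneg N
  have hnN : (0 : ℝ) < (n : ℝ) + N := by linarith
  have hnN' : (n : ℝ) + N ≠ 0 := hnN.ne'
  refine ⟨1 / (4 * ((n : ℝ) + N)), by positivity, ?_⟩
  obtain ⟨q₀, hq₀⟩ := exists_nat_ge (C ^ 2 + 2)
  refine ⟨q₀, fun q hq d hd => ?_⟩
  -- Basic facts about `q`.
  have hq2 : C ^ 2 + 2 ≤ (q : ℝ) := hq₀.trans (by exact_mod_cast hq)
  have hq1 : (1 : ℝ) < q := by linarith [sq_nonneg C]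
  have hq0 : (0 : ℝ) < q := by linarith
  -- `y := q ^ (1 / 4)`.
  have hy1 : 1 < (q : ℝ) ^ (1 / 4 : ℝ) := Real.one_lt_rpow hq1 (by norm_num)
  have hy4 : ((q : ℝ) ^ (1 / 4 : ℝ)) ^ 4 = (q : ℝ) := by
    rw [← Real.rpow_natCast, ← Real.rpow_mul hq0.le]
    norm_num
  -- `x := q ^ δ` with `δ := 1 / (4 * (n + N))`.
  have hx1 : 1 ≤ (q : ℝ) ^ (1 / (4 * ((n : ℝ) + N))) := Real.one_le_rpow hq1.le (by positivity)
  have hxy : ((q : ℝ) ^ (1 / (4 * ((n : ℝ) + N)))) ^ (n + N) = (q : ℝ) ^ (1 / 4 : ℝ) := by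
    rw [← Real.rpow_natCast, ← Real.rpow_mul hq0.le]
    congr 1
    push_cast
    field_simp
  -- Bounds on the two factors.
  have hd1 : (d : ℝ) + 1 ≤ 2 * (q : ℝ) ^ (1 / (4 * ((n : ℝ) + N))) := by linarith
  have hqn : (1 : ℝ) ≤ (q : ℝ) * n := one_le_mul_of_one_le_of_one_le hq1.le hn1
  have hqnx : (1 : ℝ) ≤ (q : ℝ) * n * (q : ℝ) ^ (1 / (4 * ((n : ℝ) + N))) :=
    one_le_mul_of_one_le_of_one_le hqn hx1
  have hqnd : (q : ℝ) * n * d ≤ (q : ℝ) * n * (q : ℝ) ^ (1 / (4 * ((n : ℝ) + N))) :=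
    mul_le_mul_of_nonneg_left hd (by positivity)
  have hd2 : (q : ℝ) * n * d + 1 ≤ 2 * n * (q : ℝ) * (q : ℝ) ^ (1 / (4 * ((n : ℝ) + N))) := by
    linarith
  -- The left-hand side is at most `C * (q ^ N * y)`.
  have hLHS : (((d + 1) ^ n * (q * n * d + 1) ^ N : ℕ) : ℝ) ≤
      C * ((q : ℝ) ^ N * (q : ℝ) ^ (1 / 4 : ℝ)) := by
    push_cast
    calc ((d : ℝ) + 1) ^ n * ((q : ℝ) * n * d + 1) ^ N
        ≤ (2 * (q : ℝ) ^ (1 / (4 * ((n : ℝ) + N)))) ^ n *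
            (2 * n * (q : ℝ) * (q : ℝ) ^ (1 / (4 * ((n : ℝ) + N)))) ^ N := by
          gcongr
      _ = 2 ^ n * (2 * (n : ℝ)) ^ N *
            ((q : ℝ) ^ N * ((q : ℝ) ^ (1 / (4 * ((n : ℝ) + N)))) ^ (n + N)) := by ring
      _ = C * ((q : ℝ) ^ N * (q : ℝ) ^ (1 / 4 : ℝ)) := by rw [hxy, hC]
  -- The right-hand side is `y ^ (4 * N + n)`.
  have hRHS : (q : ℝ) ^ ((n : ℝ) ^ 2 / 2 - 1 / 4 * (n : ℝ)) =
      ((q : ℝ) ^ (1 / 4 : ℝ)) ^ (4 * N + n) := by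
    rw [← Real.rpow_natCast _ (4 * N + n), ← Real.rpow_mul hq0.le]
    congr 1
    push_cast
    linear_combination (-1 / 2 : ℝ) * hNreal
  -- Conclude by pure algebra in `y`.
  rw [hRHS]
  set y : ℝ := (q : ℝ) ^ (1 / 4 : ℝ) with hy
  have hy0 : 0 < y := by linarith
  have hCy2 : C < y ^ 2 := by
    by_contra h
    have h' : y ^ 2 ≤ C := not_lt.mp h
    have : (y ^ 2) ^ 2 ≤ C ^ 2 := by gcongr
    nlinarith
  have hCy : C < y ^ (n - 1) := hCy2.trans_le (pow_le_pow_right₀ hy1.le (by omega))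
  calc (((d + 1) ^ n * (q * n * d + 1) ^ N : ℕ) : ℝ)
      ≤ C * ((q : ℝ) ^ N * y) := hLHS
    _ = C * y ^ (4 * N + 1) := by rw [← hy4]; ring
    _ < y ^ (n - 1) * y ^ (4 * N + 1) := mul_lt_mul_of_pos_right hCy (pow_pos hy0 _)
    _ = y ^ (4 * N + n) := by rw [← pow_add]; congr 1; omega

end Summit.MatrixMultiplication.MatrixMultiplication.Theorems.BorderHalfDimensionDesigns
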